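import Summits.Ventures.PackingBounds.Configurations.IcosahedronNbr
import Summits.Ventures.PackingBounds.Configurations.GramIsometry
import Summits.Ventures.PackingBounds.Configurations.Icosahedron

/-!
# Uniqueness of the regular icosahedron as a 12-point ground state / `{−1, ±1/√5}`-code on `S²`

Framing: lottery ticket; floor = certified bounds/negative ranges. Venture `PackingBounds` (cell
`pub-packcert`, seat `pub-packcert-energy`) — Cohn–Kumar Table 1, row `(3, 12)`, uniqueness column; continuation of
`IcosahedronNbr.lean` (neighbour sets, the `2 + 2` split, the pentagon step `step`).

Walking around a vertex (`y_{i+1} = g(x + y_i) - y_{i-1}`, `g = (√5-1)/2`) exhibits the five neighbours of `x` as a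
pentagon and `C` as the image of the fixed family `fam x y₁ y₂ : Fin 12 → ℝ³` (`exists_eq_image_fam`), whose Gram
matrix depends only on that of `(x, y₁, y₂)` (`inner_fam_eq`); `GramIsometry.exists_linearIsometryEquiv_of_inner_eq`
then gives: any two 12-point configurations on `S²` with inner products in `{-1} ∪ {t² = 1/5}` are isometric
(`isometric`), each is an isometric image of `Config.Icosahedron.pts` (`isometric_icosahedron`), and — with
`IcosahedronEnergyRigidity` — **the regular icosahedron is the unique 12-point ground state on `S²` of every
`(1+t)^k`, `k ≥ 6`** (`isometric_icosahedron_of_ckPow_energy_eq`).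

## References
* H. Cohn, A. Kumar, J. Amer. Math. Soc. 20 (2007) 99–148, Theorem 1.2 and Table 1. [`CohnKumar2006`]
-/

noncomputable section

namespace Summit.Ventures.PackingBounds.Config.IcosahedronUnique

open Finset Module IcosahedronNbr

/-- `(√5)² = 5`, `2.236 < √5 < 2.2361`. -/
private theorem s5 : Real.sqrt 5 ^ 2 = 5 ∧ (2.236 : ℝ) < Real.sqrt 5 ∧ Real.sqrt 5 < 2.2361 :=
  ⟨Real.sq_sqrt (by norm_num), (Real.lt_sqrt (by norm_num)).mpr (by norm_num),
    (Real.sqrt_lt' (by norm_num)).mpr (by norm_num)⟩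

/-! ### The explicit twelve-point family -/


/-- The twelve points generated from `(x, y₁, y₂)` by the pentagon walk `y_{i+1} = g(x + y_i) - y_{i-1}`,
`g = (√5-1)/2`, and central symmetry. -/
def fam (x y₁ y₂ : EuclideanSpace ℝ (Fin 3)) (i : Fin 12) : EuclideanSpace ℝ (Fin 3) :=
  let g : ℝ := (Real.sqrt 5 - 1) / 2
  let y₃ := g • (x + y₂) - y₁
  let y₄ := g • (x + y₃) - y₂
  let y₅ := g • (x + y₄) - y₃
  match i.val with
  | 0 => x | 1 => y₁ | 2 => y₂ | 3 => y₃ | 4 => y₄ | 5 => y₅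
  | 6 => -x | 7 => -y₁ | 8 => -y₂ | 9 => -y₃ | 10 => -y₄ | _ => -y₅

set_option maxHeartbeats 4000000 in
/-- **The Gram matrix of the family only depends on the Gram matrix of `(x, y₁, y₂)`.** -/
theorem inner_fam_eq {x y₁ y₂ x' y₁' y₂' : EuclideanSpace ℝ (Fin 3)}
    (hxx : inner ℝ x x = inner ℝ x' x') (h11 : inner ℝ y₁ y₁ = inner ℝ y₁' y₁')
    (h22 : inner ℝ y₂ y₂ = inner ℝ y₂' y₂') (hx1 : inner ℝ x y₁ = inner ℝ x' y₁')
    (hx2 : inner ℝ x y₂ = inner ℝ x' y₂') (h12 : inner ℝ y₁ y₂ = inner ℝ y₁' y₂') (i j : Fin 12) :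
    inner ℝ (fam x y₁ y₂ i) (fam x y₁ y₂ j) = inner ℝ (fam x' y₁' y₂' i) (fam x' y₁' y₂' j) := by
  have h1x : inner ℝ y₁ x = inner ℝ y₁' x' := by rw [real_inner_comm, hx1, real_inner_comm]
  have h2x : inner ℝ y₂ x = inner ℝ y₂' x' := by rw [real_inner_comm, hx2, real_inner_comm]
  have h21 : inner ℝ y₂ y₁ = inner ℝ y₂' y₁' := by rw [real_inner_comm, h12, real_inner_comm]
  fin_cases i <;> fin_cases j <;>
    simp only [fam, inner_add_left, inner_add_right, inner_sub_left, inner_sub_right,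
      inner_neg_left, inner_neg_right, real_inner_smul_left, real_inner_smul_right,
      hxx, h11, h22, hx1, hx2, h12, h1x, h2x, h21]

section config2

variable {C : Finset (EuclideanSpace ℝ (Fin 3))} (h1 : ∀ x ∈ C, ‖x‖ = 1) (hN : C.card = 12)
  (hv : ∀ x ∈ C, ∀ y ∈ C, x ≠ y → inner ℝ x y = -1 ∨ inner ℝ x y ^ 2 = 1 / 5)
include h1 hN hv

set_option maxHeartbeats 4000000 in
/-- **The pentagon walk.** `C` is the image of `fam x y₁ y₂` for suitable `x, y₁, y₂ ∈ C` with
`⟪x,y₁⟫ = ⟪x,y₂⟫ = ⟪y₁,y₂⟫ = √5/5`. -/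
theorem exists_eq_image_fam : ∃ x y₁ y₂ : EuclideanSpace ℝ (Fin 3), x ∈ C ∧ y₁ ∈ C ∧ y₂ ∈ C ∧
    inner ℝ x y₁ = Real.sqrt 5 / 5 ∧ inner ℝ x y₂ = Real.sqrt 5 / 5 ∧ inner ℝ y₁ y₂ = Real.sqrt 5 / 5 ∧
    C = (univ : Finset (Fin 12)).image (fam x y₁ y₂) := by
  classical
  obtain ⟨h5, hlo, hhi⟩ := s5
  set a : ℝ := Real.sqrt 5 / 5 with hadef
  set g : ℝ := (Real.sqrt 5 - 1) / 2 with hgdef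
  have ha0 : 0 < a := by rw [hadef]; positivity
  -- scalar identities
  have hI : g * (1 + a) - a = a := by rw [hgdef, hadef]; linear_combination (1 / 10 : ℝ) * h5
  have hII : g * (a + a) - 1 = -a := by rw [hgdef, hadef]; linear_combination (1 / 5 : ℝ) * h5
  have hIII : g * (a + a) + a = 1 := by rw [hgdef, hadef]; linear_combination (1 / 5 : ℝ) * h5
  -- a point, a neighbour, a neighbour of the neighbour
  have hCne : C.Nonempty := by rw [← Finset.card_pos, hN]; norm_num
  obtain ⟨x, hx⟩ := hCne
  set N := C.filter fun y => inner ℝ x y = a with hNdef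
  have hN5 : N.card = 5 := card_nbr h1 hN hv hx
  obtain ⟨y₁, hy₁N⟩ : N.Nonempty := by rw [← Finset.card_pos, hN5]; norm_num
  have hy₁ : y₁ ∈ C ∧ inner ℝ x y₁ = a := by simpa [hNdef] using hy₁N
  set S₁ := N.filter fun y => y ≠ y₁ ∧ inner ℝ y₁ y = a with hS₁
  have hS₁2 : S₁.card = 2 := card_filter_eq_two h1 hN hv hx hy₁.1 hy₁.2
  obtain ⟨y₂, hy₂S⟩ : S₁.Nonempty := by rw [← Finset.card_pos, hS₁2]; norm_num
  have hy₂ : (y₂ ∈ C ∧ inner ℝ x y₂ = a) ∧ y₂ ≠ y₁ ∧ inner ℝ y₁ y₂ = a := by simpa [hS₁, hNdef] using hy₂S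
  -- unit norms as inner products
  have nx : inner ℝ x x = 1 := by rw [real_inner_self_eq_norm_sq, h1 x hx]; norm_num
  have n1 : inner ℝ y₁ y₁ = 1 := by rw [real_inner_self_eq_norm_sq, h1 y₁ hy₁.1]; norm_num
  have n2 : inner ℝ y₂ y₂ = 1 := by rw [real_inner_self_eq_norm_sq, h1 y₂ hy₂.1.1]; norm_num
  have ix1 := hy₁.2
  have ix2 := hy₂.1.2
  have i12 := hy₂.2.2
  have i21 : inner ℝ y₂ y₁ = a := by rw [real_inner_comm]; exact i12
  -- the walk
  set y₃ := g • (x + y₂) - y₁ with hy₃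
  obtain ⟨hy₃C, ix3, h31, i23⟩ := step h1 hN hv hx hy₂.1.1 ix2 hy₁.1 ix1 hy₂.2.1.symm i21
  rw [← hy₃] at hy₃C ix3 h31 i23
  rw [← hadef] at ix3 i23
  have i13 : inner ℝ y₁ y₃ = -a := by
    rw [hy₃, inner_sub_right, real_inner_smul_right, inner_add_right, real_inner_comm x y₁, ix1, i12, n1]; exact hII
  have n3 : inner ℝ y₃ y₃ = 1 := by
    have : inner ℝ y₃ y₃ = g * (inner ℝ y₃ x + inner ℝ y₃ y₂) - inner ℝ y₃ y₁ := by
      conv_lhs => rw [hy₃]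
      rw [inner_sub_right, real_inner_smul_right, inner_add_right]
    rw [this, real_inner_comm x y₃, ix3, real_inner_comm y₂ y₃, i23, real_inner_comm y₁ y₃, i13]
    linear_combination hIII
  have ha1' : a < 1 := by rw [hadef]; nlinarith
  have h32 : y₂ ≠ y₃ := by intro h; rw [← h, n2] at i23; linarith
  set y₄ := g • (x + y₃) - y₂ with hy₄
  have i32 : inner ℝ y₃ y₂ = a := by rw [real_inner_comm]; exact i23
  obtain ⟨hy₄C, ix4, h42, i34⟩ := step h1 hN hv hx hy₃C ix3 hy₂.1.1 ix2 h32 i32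
  rw [← hy₄] at hy₄C ix4 h42 i34
  rw [← hadef] at ix4 i34
  have i24 : inner ℝ y₂ y₄ = -a := by
    rw [hy₄, inner_sub_right, real_inner_smul_right, inner_add_right, real_inner_comm x y₂, ix2, i23, n2]
    exact hII
  have i14 : inner ℝ y₁ y₄ = -a := by
    rw [hy₄, inner_sub_right, real_inner_smul_right, inner_add_right, real_inner_comm x y₁, ix1, i13, i12]
    ring
  have n4 : inner ℝ y₄ y₄ = 1 := by
    have : inner ℝ y₄ y₄ = g * (inner ℝ y₄ x + inner ℝ y₄ y₃) - inner ℝ y₄ y₂ := by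
      conv_lhs => rw [hy₄]
      rw [inner_sub_right, real_inner_smul_right, inner_add_right]
    rw [this, real_inner_comm x y₄, ix4, real_inner_comm y₃ y₄, i34, real_inner_comm y₂ y₄, i24]
    linear_combination hIII
  have h43 : y₃ ≠ y₄ := by intro h; rw [← h, n3] at i34; linarith
  set y₅ := g • (x + y₄) - y₃ with hy₅
  have i43 : inner ℝ y₄ y₃ = a := by rw [real_inner_comm]; exact i34
  obtain ⟨hy₅C, ix5, h53, i45⟩ := step h1 hN hv hx hy₄C ix4 hy₃C ix3 h43 i43
  rw [← hy₅] at hy₅C ix5 h53 i45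
  rw [← hadef] at ix5 i45
  have i35 : inner ℝ y₃ y₅ = -a := by
    rw [hy₅, inner_sub_right, real_inner_smul_right, inner_add_right, real_inner_comm x y₃, ix3, i34, n3]
    exact hII
  have i25 : inner ℝ y₂ y₅ = -a := by
    rw [hy₅, inner_sub_right, real_inner_smul_right, inner_add_right, real_inner_comm x y₂, ix2, i24, i23]
    ring
  have i15 : inner ℝ y₁ y₅ = a := by
    rw [hy₅, inner_sub_right, real_inner_smul_right, inner_add_right, real_inner_comm x y₁, ix1, i14, i13]
    ring
  -- the five neighbours are distinct, hence exhaust `N`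
  have ha1 : a ≠ 1 := by rw [hadef]; nlinarith
  have hna1 : -a ≠ 1 := by rw [hadef]; nlinarith
  have ne_of_inner : ∀ {u v : EuclideanSpace ℝ (Fin 3)}, u ∈ C → inner ℝ u v ≠ 1 → u ≠ v := by
    intro u v hu h huv
    apply h; rw [← huv, real_inner_self_eq_norm_sq, h1 u hu]; norm_num
  have d12 := ne_of_inner hy₁.1 (by rw [i12]; exact ha1)
  have d13 := ne_of_inner hy₁.1 (by rw [i13]; exact hna1)
  have d14 := ne_of_inner hy₁.1 (by rw [i14]; exact hna1)
  have d15 := ne_of_inner hy₁.1 (by rw [i15]; exact ha1)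
  have d23 := ne_of_inner hy₂.1.1 (by rw [i23]; exact ha1)
  have d24 := ne_of_inner hy₂.1.1 (by rw [i24]; exact hna1)
  have d25 := ne_of_inner hy₂.1.1 (by rw [i25]; exact hna1)
  have d34 := ne_of_inner hy₃C (by rw [i34]; exact ha1)
  have d35 := ne_of_inner hy₃C (by rw [i35]; exact hna1)
  have d45 := ne_of_inner hy₄C (by rw [i45]; exact ha1)
  have hsubN : ({y₁, y₂, y₃, y₄, y₅} : Finset _) ⊆ N := by
    intro y hy
    simp only [mem_insert, mem_singleton] at hy
    rw [hNdef, mem_filter]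
    rcases hy with rfl | rfl | rfl | rfl | rfl
    · exact hy₁
    · exact hy₂.1
    · exact ⟨hy₃C, ix3⟩
    · exact ⟨hy₄C, ix4⟩
    · exact ⟨hy₅C, ix5⟩
  have hcard5 : ({y₁, y₂, y₃, y₄, y₅} : Finset _).card = 5 := by
    rw [card_insert_of_notMem, card_insert_of_notMem, card_insert_of_notMem, card_pair d45]
    · simp [d34, d35]
    · simp [d23, d24, d25]
    · simp [d12, d13, d14, d15]
  have hNeq : N = {y₁, y₂, y₃, y₄, y₅} :=
    (Finset.eq_of_subset_of_card_le hsubN (by rw [hN5, hcard5])).symm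
  -- `C = {x, -x} ∪ N ∪ (-N)`
  have hnegC : ∀ y ∈ C, -y ∈ C := fun y hy => IcosahedronLines.neg_mem h1 hN hv hy
  refine ⟨x, y₁, y₂, hx, hy₁.1, hy₂.1.1, ix1, ix2, i12, ?_⟩
  apply Finset.eq_of_superset_of_card_ge
  · -- every `fam` value lies in `C`
    intro z hz
    simp only [mem_image, mem_univ, true_and] at hz
    obtain ⟨i, rfl⟩ := hz
    fin_cases i <;> simp only [fam] <;> (try simp only [← hgdef]) <;> (try simp only [← hy₃]) <;>
      (try simp only [← hy₄]) <;> (try simp only [← hy₅]) <;>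
      first
        | exact hx | exact hy₁.1 | exact hy₂.1.1 | exact hy₃C | exact hy₄C | exact hy₅C
        | exact hnegC _ hx | exact hnegC _ hy₁.1 | exact hnegC _ hy₂.1.1 | exact hnegC _ hy₃C
        | exact hnegC _ hy₄C | exact hnegC _ hy₅C
  · rw [hN]
    -- the twelve values are distinct: their Gram matrix has no off-diagonal `1`
    have hinj : Function.Injective (fam x y₁ y₂) := by
      intro i j hij
      by_contra hne
      have hii : inner ℝ (fam x y₁ y₂ i) (fam x y₁ y₂ j) = 1 := by
        rw [hij, real_inner_self_eq_norm_sq]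
        have : fam x y₁ y₂ j ∈ C := by
          fin_cases j <;> simp only [fam] <;> (try simp only [← hgdef]) <;>
            (try simp only [← hy₃]) <;> (try simp only [← hy₄]) <;> (try simp only [← hy₅]) <;>
            first
              | exact hx | exact hy₁.1 | exact hy₂.1.1 | exact hy₃C | exact hy₄C | exact hy₅C
              | exact hnegC _ hx | exact hnegC _ hy₁.1 | exact hnegC _ hy₂.1.1 | exact hnegC _ hy₃C
              | exact hnegC _ hy₄C | exact hnegC _ hy₅C
        rw [h1 _ this]; norm_num
      have i31 : inner ℝ y₃ y₁ = -a := by rw [real_inner_comm]; exact i13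
      have i41 : inner ℝ y₄ y₁ = -a := by rw [real_inner_comm]; exact i14
      have i51 : inner ℝ y₅ y₁ = a := by rw [real_inner_comm]; exact i15
      have i42 : inner ℝ y₄ y₂ = -a := by rw [real_inner_comm]; exact i24
      have i52 : inner ℝ y₅ y₂ = -a := by rw [real_inner_comm]; exact i25
      have i53 : inner ℝ y₅ y₃ = -a := by rw [real_inner_comm]; exact i35
      have i54 : inner ℝ y₅ y₄ = a := by rw [real_inner_comm]; exact i45
      have i1x : inner ℝ y₁ x = a := by rw [real_inner_comm]; exact ix1
      have i2x : inner ℝ y₂ x = a := by rw [real_inner_comm]; exact ix2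
      have i3x : inner ℝ y₃ x = a := by rw [real_inner_comm]; exact ix3
      have i4x : inner ℝ y₄ x = a := by rw [real_inner_comm]; exact ix4
      have i5x : inner ℝ y₅ x = a := by rw [real_inner_comm]; exact ix5
      have n5 : inner ℝ y₅ y₅ = 1 := by rw [real_inner_self_eq_norm_sq, h1 _ hy₅C]; norm_num
      fin_cases i <;> fin_cases j <;>
        first
          | exact hne rfl
          | (simp only [fam] at hii
             try simp only [← hgdef] at hii
             try simp only [← hy₃] at hii
             try simp only [← hy₄] at hii
             try simp only [← hy₅] at hii
             simp only [inner_neg_left, inner_neg_right, neg_neg, nx, n1, n2, n3, n4, n5, ix1, ix2,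
              ix3, ix4, ix5, i1x, i2x, i3x, i4x, i5x, i12, i21, i13, i31, i14, i41, i15, i51, i23, i32, i24,
              i42, i25, i52, i34, i43, i35, i53, i45, i54] at hii
             linarith)
    rw [card_image_of_injective _ hinj]; simp

/-- **Uniqueness.** Any two `12`-point configurations on `S²` whose inner products lie in `{-1} ∪ {t² = 1/5}`
are isometric. [cite: CohnKumar2006, Table 1] -/
theorem isometric {C' : Finset (EuclideanSpace ℝ (Fin 3))} (h1' : ∀ x ∈ C', ‖x‖ = 1) (hN' : C'.card = 12)
    (hv' : ∀ x ∈ C', ∀ y ∈ C', x ≠ y → inner ℝ x y = -1 ∨ inner ℝ x y ^ 2 = 1 / 5) :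
    ∃ Ψ : EuclideanSpace ℝ (Fin 3) ≃ₗᵢ[ℝ] EuclideanSpace ℝ (Fin 3), C' = C.image Ψ := by
  classical
  obtain ⟨x, y₁, y₂, hx, hy₁, hy₂, ix1, ix2, i12, hC⟩ := exists_eq_image_fam h1 hN hv
  obtain ⟨x', y₁', y₂', hx', hy₁', hy₂', ix1', ix2', i12', hC'⟩ := exists_eq_image_fam h1' hN' hv'
  have hgram : ∀ i j, inner ℝ (fam x y₁ y₂ i) (fam x y₁ y₂ j) = inner ℝ (fam x' y₁' y₂' i) (fam x' y₁' y₂' j) :=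
    inner_fam_eq
      (by rw [real_inner_self_eq_norm_sq, real_inner_self_eq_norm_sq, h1 x hx, h1' x' hx'])
      (by rw [real_inner_self_eq_norm_sq, real_inner_self_eq_norm_sq, h1 y₁ hy₁, h1' y₁' hy₁'])
      (by rw [real_inner_self_eq_norm_sq, real_inner_self_eq_norm_sq, h1 y₂ hy₂, h1' y₂' hy₂'])
      (by rw [ix1, ix1']) (by rw [ix2, ix2']) (by rw [i12, i12'])
  obtain ⟨Ψ, hΨ⟩ := exists_linearIsometryEquiv_of_inner_eq _ _ hgram
  refine ⟨Ψ, ?_⟩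
  rw [hC', hC, Finset.image_image]
  exact Finset.image_congr fun i _ => (hΨ i).symm

end config2

/-- Kernel check: the icosahedron's lists have length `3` and squared length `q`. -/
private theorem ico_shape : shapeOK Icosahedron.vecs 3 (⟨10, 2⟩ : (Zsqrtd 5)) = true := by decide +kernel

/-- **The regular icosahedron is the unique such configuration**: every `12`-point configuration on `S²` with inner
products in `{-1} ∪ {t² = 1/5}` is an isometric image of `Config.Icosahedron.pts`. [cite: CohnKumar2006, Table 1] -/
theorem isometric_icosahedron {C : Finset (EuclideanSpace ℝ (Fin 3))} (h1 : ∀ x ∈ C, ‖x‖ = 1)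
    (hN : C.card = 12) (hv : ∀ x ∈ C, ∀ y ∈ C, x ≠ y → inner ℝ x y = -1 ∨ inner ℝ x y ^ 2 = 1 / 5) :
    ∃ Ψ : EuclideanSpace ℝ (Fin 3) ≃ₗᵢ[ℝ] EuclideanSpace ℝ (Fin 3), C = Icosahedron.pts.image Ψ := by
  classical
  obtain ⟨h5, hlo, hhi⟩ := s5
  have hq : 0 < (Zsqrtd.toReal Icosahedron.h5) (⟨10, 2⟩ : (Zsqrtd 5)) := by
    rw [Zsqrtd.toReal_apply]; push_cast; nlinarith [Real.sqrt_nonneg 5]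
  have hn1 : ∀ x ∈ Icosahedron.pts, ‖x‖ = 1 := norm_eq_one hq ico_shape
  -- node set of the icosahedron, read off its energy identity with an indicator potential
  have hvI : ∀ x ∈ Icosahedron.pts, ∀ y ∈ Icosahedron.pts, x ≠ y →
      inner ℝ x y = -1 ∨ inner ℝ x y ^ 2 = 1 / 5 := by
    set ind : ℝ → ℝ := fun t => if (t = -1 ∨ t ^ 2 = 1 / 5) then 0 else 1 with hind
    have hE := Icosahedron.energy_pts ind
    have hval : ind (-1) = 0 ∧ ind (-(Real.sqrt 5 / 5)) = 0 ∧ ind (Real.sqrt 5 / 5) = 0 := by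
      refine ⟨by simp [hind], ?_, ?_⟩ <;>
      · simp only [hind]; rw [if_pos]; right; nlinarith
    rw [hval.1, hval.2.1, hval.2.2] at hE
    norm_num at hE
    have hnn : ∀ x ∈ Icosahedron.pts, ∀ y ∈ Icosahedron.pts.erase x, 0 ≤ ind (inner ℝ x y) := by
      intro x _ y _; simp only [hind]; split_ifs <;> norm_num
    intro x hx y hy hxy
    have hx0 := (Finset.sum_eq_zero_iff_of_nonneg fun x hx => Finset.sum_nonneg fun y hy => hnn x hx y hy).mp hE x hx
    have h0 := (Finset.sum_eq_zero_iff_of_nonneg fun y hy => hnn x hx y hy).mp hx0 y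
      (Finset.mem_erase.mpr ⟨hxy.symm, hy⟩)
    simp only [hind] at h0
    by_contra hc
    rw [if_neg hc] at h0
    exact one_ne_zero h0
  exact isometric hn1 Icosahedron.card_pts hvI h1 hN hv

/-- **Ground-state form** (with `IcosahedronEnergyRigidity`): every `12`-point configuration on `S²` attaining the
universal lower bound of the `(1+t)^k`-energy for one `k ≥ 6` is an isometric image of the regular icosahedron —
the icosahedron is the unique ground state (Cohn–Kumar Thm 1.2, uniqueness for the row `(3, 12)`).
[cite: CohnKumar2006, Theorem 1.2 and Table 1] -/
theorem isometric_icosahedron_of_ckPow_energy_eq {C : Finset (EuclideanSpace ℝ (Fin 3))}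
    (h1 : ∀ x ∈ C, ‖x‖ = 1) (hN : C.card = 12) (k : ℕ) (hk : 6 ≤ k)
    (hE : ∑ x ∈ C, ∑ y ∈ C.erase x, (1 + inner ℝ x y) ^ k =
      (12 : ℝ) * ((1 + (-1 : ℝ)) ^ k + 5 * (1 + (-(Real.sqrt 5 / 5))) ^ k + 5 * (1 + Real.sqrt 5 / 5) ^ k)) :
    ∃ Ψ : EuclideanSpace ℝ (Fin 3) ≃ₗᵢ[ℝ] EuclideanSpace ℝ (Fin 3), C = Icosahedron.pts.image Ψ :=
  isometric_icosahedron h1 hN (IcosahedronEnergyRigidity.inner_mem_of_ckPow_energy_eq h1 hN k hk hE)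

end Summit.Ventures.PackingBounds.Config.IcosahedronUnique

end
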